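import Mathlib
import Literature.NumberTheory.LFunctions.MoebiusWalshCircuitsACdProofs
import HarnessLib

/-!
# Crux `DigitPolyUniformity` (stmt-QuantumAdvantage-1392), line `Sketch`, cycle 7 — Stub KMT-V

2-adic valuation split of the block/residue sums of the Liouville function `λ`.
For `k ≤ h`, the residues `a < 2^k` split according to `v₂(a)`: `a = 0`, or `a = 2^j a'` with `j < k` and
`a'` odd, `a' < 2^(k-j)`.  Since `λ(2m) = -λ(m)` for every `m` (the tree's
`Literature.NumberTheory.LFunctions.Green2012.liouville_two_mul`), the class `N ≡ 2^j a' (mod 2^k)` inside the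
aligned block `[2^h y, 2^h y + 2^h)` is `2^j ×` the class `N' ≡ a' (mod 2^(k-j))` inside the block
`[2^(h-j) y, 2^(h-j) y + 2^(h-j))`, with `Σ λ` multiplied by `(-1)^j`; and the class of `0` is `2^k ×` the
plain block `[2^(h-k) y, 2^(h-k) y + 2^(h-k))`.  Hence

  `Σ_{a<2^k} |Σ_{N ∈ block_h y, N ≡ a (2^k)} λ(N)|
     = Σ_{j<k} Σ_{a'<2^(k-j) odd} |Σ_{N ∈ block_{h-j} y, N ≡ a' (2^(k-j))} λ(N)| + |Σ_{N ∈ block_{h-k} y} λ(N)|`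

(`perBlock_eq`, by induction on `k`: peel off the lowest binary digit of `a`, the even residues `a = 2b`
modulo `2^(k+1)` in blocks of length `2^(h+1)` being the residues `b` modulo `2^k` in blocks of length `2^h`,
`classSum_succ`), and summing over the `2^(n-h)` blocks gives the registered inequality (in fact an
equality, `valuation_split_eq`); the `y`-ranges `2^((n-j)-(h-j))`, `2^((n-k)-(h-k))` all equal `2^(n-h)`
for `j < k ≤ h` (truncated subtraction included).
-/

noncomputable section

namespace Summit.QuantumAdvantage.DigitPolyUniformity.SketchLAR.KMT

open Finset

namespace ValuationSplit

/-- Halving an even residue class: `N ↦ 2N` is a bijection from the class `N' ≡ b (mod m)` inside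
`[B, B + L)` onto the class `N ≡ 2b (mod 2m)` inside `[2B, 2B + 2L)`, and `λ(2N') = -λ(N')`, so the two
class sums of `λ` differ by a sign. [folklore] -/
theorem classSum_double (B L m b : ℕ) :
    ∑ N ∈ (Ico (2 * B) (2 * B + 2 * L)).filter (fun N => N % (2 * m) = 2 * b),
        ((ArithmeticFunction.liouville N : ℤ) : ℝ) =
      -∑ N ∈ (Ico B (B + L)).filter (fun N => N % m = b),
        ((ArithmeticFunction.liouville N : ℤ) : ℝ) := by
  rw [← sum_neg_distrib]
  symm
  refine sum_nbij' (fun N => 2 * N) (fun N => N / 2) ?_ ?_ ?_ ?_ ?_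
  · intro N hN
    simp only [mem_filter, mem_Ico] at hN ⊢
    refine ⟨⟨?_, ?_⟩, ?_⟩
    · omega
    · omega
    · rw [Nat.mul_mod_mul_left, hN.2]
  · intro N hN
    simp only [mem_filter, mem_Ico] at hN ⊢
    have h1 := Nat.div_add_mod N (2 * m)
    rw [mul_assoc] at h1
    obtain ⟨N', rfl⟩ : 2 ∣ N := by omega
    rw [Nat.mul_mod_mul_left] at hN
    rw [Nat.mul_div_cancel_left _ Nat.two_pos]
    refine ⟨⟨?_, ?_⟩, ?_⟩ <;> omega
  · intro N _
    simp
  · intro N hN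
    simp only [mem_filter, mem_Ico] at hN
    have h1 := Nat.div_add_mod N (2 * m)
    rw [mul_assoc] at h1
    omega
  · intro N _
    rw [Literature.NumberTheory.LFunctions.Green2012.liouville_two_mul]
    push_cast
    ring

/-- The case `B = 2^h y`, `L = 2^h`, `m = 2^k` of `classSum_double`: the even residue `2b` modulo
`2^(k+1)` in the aligned block of length `2^(h+1)` versus the residue `b` modulo `2^k` in the aligned
block of length `2^h`. [folklore] -/
theorem classSum_succ (h k y b : ℕ) :
    ∑ N ∈ (Ico (2 ^ (h + 1) * y) (2 ^ (h + 1) * y + 2 ^ (h + 1))).filter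
        (fun N => N % 2 ^ (k + 1) = 2 * b), ((ArithmeticFunction.liouville N : ℤ) : ℝ) =
      -∑ N ∈ (Ico (2 ^ h * y) (2 ^ h * y + 2 ^ h)).filter (fun N => N % 2 ^ k = b),
        ((ArithmeticFunction.liouville N : ℤ) : ℝ) := by
  rw [show 2 ^ (h + 1) * y = 2 * (2 ^ h * y) by ring, show (2 : ℕ) ^ (h + 1) = 2 * 2 ^ h by ring,
    show (2 : ℕ) ^ (k + 1) = 2 * 2 ^ k by ring]
  exact classSum_double _ _ _ _

/-- Odd/even splitting of a sum over `range (2M)`: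
`Σ_{a < 2M} G a = Σ_{a < 2M, a odd} G a + Σ_{b < M} G (2b)`. [folklore] -/
theorem sum_range_odd_add_even (G : ℕ → ℝ) (M : ℕ) :
    ∑ a ∈ range (2 * M), G a =
      ∑ a ∈ (range (2 * M)).filter (fun a => Odd a), G a + ∑ b ∈ range M, G (2 * b) := by
  rw [← sum_filter_add_sum_filter_not (range (2 * M)) (fun a => Odd a) G]
  congr 1
  symm
  refine sum_nbij' (fun b => 2 * b) (fun a => a / 2) ?_ ?_ ?_ ?_ ?_
  · intro b hb
    simp only [mem_range] at hb
    simp only [mem_filter, mem_range, Nat.not_odd_iff_even]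
    exact ⟨by omega, even_two_mul b⟩
  · intro a ha
    simp only [mem_filter, mem_range] at ha
    simp only [mem_range]
    omega
  · intro b _
    simp
  · intro a ha
    simp only [mem_filter, mem_range, Nat.not_odd_iff_even] at ha
    obtain ⟨c, hc⟩ := ha.2
    omega
  · intro b _
    rfl

/-- The valuation split for one aligned block (an equality), by induction on `k`: the residues modulo
`2^(k+1)` are the odd ones (the `j = 0` term) and the even ones `2b`, `b < 2^k`, whose classes in a block
of length `2^(h+1)` are (up to sign) the classes of `b` modulo `2^k` in a block of length `2^h`.
[folklore] -/
theorem perBlock_eq (k : ℕ) : ∀ (h y : ℕ), k ≤ h →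
    ∑ a ∈ range (2 ^ k),
        |∑ N ∈ (Ico (2 ^ h * y) (2 ^ h * y + 2 ^ h)).filter (fun N => N % 2 ^ k = a),
          ((ArithmeticFunction.liouville N : ℤ) : ℝ)| =
      (∑ j ∈ range k, ∑ a ∈ (range (2 ^ (k - j))).filter (fun a => Odd a),
        |∑ N ∈ (Ico (2 ^ (h - j) * y) (2 ^ (h - j) * y + 2 ^ (h - j))).filter
            (fun N => N % 2 ^ (k - j) = a), ((ArithmeticFunction.liouville N : ℤ) : ℝ)|) +
      |∑ N ∈ Ico (2 ^ (h - k) * y) (2 ^ (h - k) * y + 2 ^ (h - k)),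
          ((ArithmeticFunction.liouville N : ℤ) : ℝ)| := by
  induction k with
  | zero =>
    intro h y _
    simp only [pow_zero, range_one, sum_singleton, range_zero, sum_empty, Nat.sub_zero, zero_add]
    rw [filter_true_of_mem fun x _ => Nat.mod_one x]
  | succ k ih =>
    intro h y hkh
    obtain ⟨h', rfl⟩ : ∃ h', h = h' + 1 := ⟨h - 1, by omega⟩
    rw [sum_range_succ']
    simp only [Nat.add_sub_add_right, Nat.sub_zero]
    rw [pow_succ' (2 : ℕ) k, sum_range_odd_add_even, ← pow_succ' (2 : ℕ) k]
    simp only [classSum_succ, abs_neg]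
    rw [ih h' y (by omega)]
    ring

/-- The registered statement as an EQUALITY: summing `perBlock_eq` over the `2^(n-h)` aligned blocks and
normalising the `y`-ranges (`(n-j)-(h-j) = (n-k)-(h-k) = n-h` for `j < k ≤ h`). [folklore] -/
theorem valuation_split_eq (n k h : ℕ) (hkh : k ≤ h) :
    ∑ y ∈ range (2 ^ (n - h)), ∑ a ∈ range (2 ^ k),
        |∑ N ∈ (Ico (2 ^ h * y) (2 ^ h * y + 2 ^ h)).filter (fun N => N % 2 ^ k = a),
          ((ArithmeticFunction.liouville N : ℤ) : ℝ)| =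
      (∑ j ∈ range k, ∑ y ∈ range (2 ^ ((n - j) - (h - j))),
        ∑ a ∈ (range (2 ^ (k - j))).filter (fun a => Odd a),
        |∑ N ∈ (Ico (2 ^ (h - j) * y) (2 ^ (h - j) * y + 2 ^ (h - j))).filter
            (fun N => N % 2 ^ (k - j) = a), ((ArithmeticFunction.liouville N : ℤ) : ℝ)|) +
      ∑ y ∈ range (2 ^ ((n - k) - (h - k))),
        |∑ N ∈ Ico (2 ^ (h - k) * y) (2 ^ (h - k) * y + 2 ^ (h - k)),
          ((ArithmeticFunction.liouville N : ℤ) : ℝ)| := by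
  rw [show n - k - (h - k) = n - h by omega, sum_congr rfl fun y _ => perBlock_eq k h y hkh,
    sum_add_distrib, sum_comm (s := range (2 ^ (n - h))) (t := range k)]
  congr 1
  refine sum_congr rfl fun j hj => ?_
  rw [mem_range] at hj
  rw [show n - j - (h - j) = n - h by omega]

end ValuationSplit

/-- **Stub KMT-V (2-adic valuation split of the residues).** For `k ≤ h` the block/residue sums of `λ`
modulo `2^k` split according to `v₂(a)`: the classes `a = 2^j a'` (`a'` odd, `j < k`) are `2^j ×` the odd
classes modulo `2^(k-j)` in blocks of length `2^(h-j)` (`λ(2^j m) = (-1)^j λ(m)`), and the class `a = 0`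
is `2^k ×` plain blocks of length `2^(h-k)`; in fact with equality (`ValuationSplit.valuation_split_eq`).
[folklore] -/
theorem stub_kmt_valuation_split (n k h : ℕ) (hkh : k ≤ h) :
    ∑ y ∈ range (2 ^ (n - h)), ∑ a ∈ range (2 ^ k),
        |∑ N ∈ (Ico (2 ^ h * y) (2 ^ h * y + 2 ^ h)).filter (fun N => N % 2 ^ k = a),
          ((ArithmeticFunction.liouville N : ℤ) : ℝ)| ≤
      (∑ j ∈ range k, ∑ y ∈ range (2 ^ ((n - j) - (h - j))), ∑ a ∈ (range (2 ^ (k - j))).filter (fun a => Odd a),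
        |∑ N ∈ (Ico (2 ^ (h - j) * y) (2 ^ (h - j) * y + 2 ^ (h - j))).filter (fun N => N % 2 ^ (k - j) = a),
          ((ArithmeticFunction.liouville N : ℤ) : ℝ)|) +
      ∑ y ∈ range (2 ^ ((n - k) - (h - k))),
        |∑ N ∈ Ico (2 ^ (h - k) * y) (2 ^ (h - k) * y + 2 ^ (h - k)), ((ArithmeticFunction.liouville N : ℤ) : ℝ)| :=
  (ValuationSplit.valuation_split_eq n k h hkh).le

end Summit.QuantumAdvantage.DigitPolyUniformity.SketchLAR.KMT
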